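import Mathlib

/-!
# T5TensorSlot — the tensor-slot argument and the algebra of N3.L7

Cell pub-hodge-repro2, Tier 5 (route/T5-N3-route-2.md v0.2, owner route-2; route/T5-N4-p5.md
(N4.3.P2-quinquies); route/T4N-route-3.md §2(i)); kernel support by seat p4.  Two pieces of pure
linear algebra that the prose uses as «[A]»:

1. THE TENSOR-SLOT ARGUMENT (P2-quinquies, T4N §2(i)): a non-zero linear map `Φ : M ⊗ N → P` is
   non-zero on some pure tensor `x ⊗ y` (`exists_tmul_ne_zero`), and then `y′ ↦ Φ (x ⊗ y′)` is a
   non-zero linear map `N → P` (`exists_slot_ne_zero`).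
2. N3.L7's span computation: «the `H(𝔸_f)`-span of `u = u_∞ ⊗ u_f` is `u_∞ ⊗ π₀,f` (`π₀,f`
   irreducible), which contains every `f` with archimedean component `u_∞`».  With a set `S` of
   operators on `N` (the group action on the finite part), acting on `M ⊗ N` through `id ⊗ T`
   (`LinearMap.lTensor M T`), and `genSpan S u` := the span of all words in `S` applied to `u`
   (the `S`-generated submodule — `mem_genSpan_self`, `genSpan_stable`, `genSpan_le` are its three
   characteristic properties, `genSpan_eq_top` the irreducibility consequence):
   `genSpan_tmul` — the `S`-generated submodule of `m ⊗ u` is the image of the `S`-generated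
   submodule of `u` under `y ↦ m ⊗ y`; `genSpan_tmul_eq_range` — it is all of `m ⊗ N` when `N` is
   `S`-irreducible and `u ≠ 0`; `tmul_mem_genSpan_tmul` — hence it contains every `m ⊗ y`.

Not modelled: the `K`-average, the equivariance of the theta kernel (N3.L3), the `K`-type facts
(row T7) — these are the prose's inputs; here `M`, `N` are arbitrary modules.
-/

namespace Summit.Ventures.HodgeRepro2.T5TensorSlot

open TensorProduct

section Slot

variable {R : Type*} [CommSemiring R] {M N P : Type*} [AddCommMonoid M] [AddCommMonoid N]
  [AddCommMonoid P] [Module R M] [Module R N] [Module R P]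

/-- **Tensor-slot argument, step 1**: a non-zero linear map on `M ⊗ N` is non-zero on some pure
tensor. -/
theorem exists_tmul_ne_zero (Φ : M ⊗[R] N →ₗ[R] P) (hΦ : Φ ≠ 0) :
    ∃ x : M, ∃ y : N, Φ (x ⊗ₜ y) ≠ 0 := by
  by_contra h
  push Not at h
  exact hΦ (TensorProduct.ext' fun x y => by simpa using h x y)

/-- **Tensor-slot argument, step 2**: for a non-zero `Φ` there is a slot `x` such that
`y ↦ Φ (x ⊗ y)` is a non-zero linear map `N → P`. -/
theorem exists_slot_ne_zero (Φ : M ⊗[R] N →ₗ[R] P) (hΦ : Φ ≠ 0) :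
    ∃ x : M, Φ ∘ₗ TensorProduct.mk R M N x ≠ 0 := by
  obtain ⟨x, y, hxy⟩ := exists_tmul_ne_zero Φ hΦ
  exact ⟨x, fun h => hxy (by simpa using LinearMap.congr_fun h y)⟩

end Slot

section GenSpan

variable {R : Type*} [CommSemiring R] {N : Type*} [AddCommMonoid N] [Module R N]

/-- A word `w = [T₁, …, Tₖ]` of operators applied to `u`: `T₁ (T₂ (… (Tₖ u)))`. -/
def wordApply (w : List (N →ₗ[R] N)) (u : N) : N := w.foldr (fun T y => T y) u

/-- The empty word acts as the identity. -/
@[simp] theorem wordApply_nil (u : N) : wordApply ([] : List (N →ₗ[R] N)) u = u := rfl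

/-- A word `T :: w` applies `w` first, then `T`. -/
@[simp] theorem wordApply_cons (T : N →ₗ[R] N) (w : List (N →ₗ[R] N)) (u : N) :
    wordApply (T :: w) u = T (wordApply w u) := rfl

/-- The `S`-generated submodule of `u`: the span of all words in `S` applied to `u`. -/
def genSpan (S : Set (N →ₗ[R] N)) (u : N) : Submodule R N :=
  Submodule.span R {x | ∃ w : List (N →ₗ[R] N), (∀ T ∈ w, T ∈ S) ∧ wordApply w u = x}

variable {S : Set (N →ₗ[R] N)} {u : N}

/-- `u` lies in its `S`-generated submodule (the empty word). -/
theorem mem_genSpan_self : u ∈ genSpan S u :=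
  Submodule.subset_span ⟨[], by simp, rfl⟩

/-- The `S`-generated submodule is stable under every `T ∈ S`. -/
theorem genSpan_stable {T : N →ₗ[R] N} (hT : T ∈ S) : (genSpan S u).map T ≤ genSpan S u := by
  rw [genSpan, Submodule.map_span, Submodule.span_le]
  rintro _ ⟨_, ⟨w, hw, rfl⟩, rfl⟩
  exact Submodule.subset_span ⟨T :: w, by simpa using ⟨hT, hw⟩, rfl⟩

/-- The `S`-generated submodule is the smallest `S`-stable submodule containing `u`. -/
theorem genSpan_le {M' : Submodule R N} (hu : u ∈ M') (hst : ∀ T ∈ S, M'.map T ≤ M') :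
    genSpan S u ≤ M' := by
  rw [genSpan, Submodule.span_le]
  rintro _ ⟨w, hw, rfl⟩
  induction w with
  | nil => simpa using hu
  | cons T w ih =>
    have hT : T ∈ S := hw T (List.mem_cons_self ..)
    have hw' : ∀ T' ∈ w, T' ∈ S := fun T' hT' => hw T' (List.mem_cons_of_mem _ hT')
    rw [wordApply_cons]
    exact hst T hT ⟨_, ih hw', rfl⟩

/-- If `N` is `S`-irreducible (every `S`-stable submodule is `⊥` or `⊤`) and `u ≠ 0`, the
`S`-generated submodule of `u` is all of `N`. -/
theorem genSpan_eq_top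
    (hirr : ∀ M' : Submodule R N, (∀ T ∈ S, M'.map T ≤ M') → M' = ⊥ ∨ M' = ⊤) (hu : u ≠ 0) :
    genSpan S u = ⊤ := by
  rcases hirr (genSpan S u) (fun T hT => genSpan_stable hT) with h | h
  · exact absurd (h ▸ mem_genSpan_self) (by simpa using hu)
  · exact h

end GenSpan

section Tensor

variable {R : Type*} [CommSemiring R] {M N : Type*} [AddCommMonoid M] [AddCommMonoid N]
  [Module R M] [Module R N]

/-- The operators `id ⊗ T`, `T ∈ S`, on `M ⊗ N` (the group acting on the finite part only). -/
def lTensorSet (M : Type*) [AddCommMonoid M] [Module R M] (S : Set (N →ₗ[R] N)) :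
    Set (M ⊗[R] N →ₗ[R] M ⊗[R] N) :=
  (LinearMap.lTensor M) '' S

/-- A word in `id ⊗ S` applied to `m ⊗ u` is `m ⊗ (the corresponding word in `S` applied to `u`). -/
theorem wordApply_map_lTensor (w : List (N →ₗ[R] N)) (m : M) (u : N) :
    wordApply (w.map (LinearMap.lTensor M)) (m ⊗ₜ u) = m ⊗ₜ wordApply w u := by
  induction w with
  | nil => rfl
  | cons T w ih => simp [ih]

/-- Every word in `id ⊗ S` is the image of a word in `S`. -/
theorem exists_word_of_mem_lTensorSet {S : Set (N →ₗ[R] N)}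
    (w : List (M ⊗[R] N →ₗ[R] M ⊗[R] N)) (hw : ∀ T ∈ w, T ∈ lTensorSet M S) :
    ∃ w' : List (N →ₗ[R] N), (∀ T ∈ w', T ∈ S) ∧ w = w'.map (LinearMap.lTensor M) := by
  induction w with
  | nil => exact ⟨[], by simp, rfl⟩
  | cons T w ih =>
    obtain ⟨T', hT', rfl⟩ := hw T (List.mem_cons_self ..)
    obtain ⟨w', hw', rfl⟩ := ih fun T hT => hw T (List.mem_cons_of_mem _ hT)
    exact ⟨T' :: w', by simpa using ⟨hT', hw'⟩, rfl⟩

/-- **N3.L7, the span computation**: the `(id ⊗ S)`-generated submodule of `m ⊗ u` is the image of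
the `S`-generated submodule of `u` under `y ↦ m ⊗ y`. -/
theorem genSpan_tmul (S : Set (N →ₗ[R] N)) (m : M) (u : N) :
    genSpan (lTensorSet M S) (m ⊗ₜ u) = (genSpan S u).map (TensorProduct.mk R M N m) := by
  rw [genSpan, genSpan, Submodule.map_span]
  congr 1
  ext x
  constructor
  · rintro ⟨w, hw, rfl⟩
    obtain ⟨w', hw', rfl⟩ := exists_word_of_mem_lTensorSet w hw
    exact ⟨wordApply w' u, ⟨w', hw', rfl⟩, (wordApply_map_lTensor w' m u).symm⟩
  · rintro ⟨_, ⟨w, hw, rfl⟩, rfl⟩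
    refine ⟨w.map (LinearMap.lTensor M), ?_, wordApply_map_lTensor w m u⟩
    intro T hT
    obtain ⟨T', hT', rfl⟩ := List.mem_map.mp hT
    exact ⟨T', hw T' hT', rfl⟩

/-- **N3.L7**: if `N` is `S`-irreducible and `u ≠ 0`, the `(id ⊗ S)`-generated submodule of
`m ⊗ u` is all of `m ⊗ N` (the range of `y ↦ m ⊗ y`). -/
theorem genSpan_tmul_eq_range (S : Set (N →ₗ[R] N)) (m : M) {u : N}
    (hirr : ∀ M' : Submodule R N, (∀ T ∈ S, M'.map T ≤ M') → M' = ⊥ ∨ M' = ⊤) (hu : u ≠ 0) :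
    genSpan (lTensorSet M S) (m ⊗ₜ u) = LinearMap.range (TensorProduct.mk R M N m) := by
  rw [genSpan_tmul, genSpan_eq_top hirr hu, Submodule.map_top]

/-- **N3.L7, the conclusion used**: under the same hypotheses every `m ⊗ y` («every `f` with
archimedean component `u_∞ = m`») lies in the `(id ⊗ S)`-generated submodule of `m ⊗ u`. -/
theorem tmul_mem_genSpan_tmul (S : Set (N →ₗ[R] N)) (m : M) {u : N}
    (hirr : ∀ M' : Submodule R N, (∀ T ∈ S, M'.map T ≤ M') → M' = ⊥ ∨ M' = ⊤) (hu : u ≠ 0)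
    (y : N) : m ⊗ₜ y ∈ genSpan (lTensorSet M S) (m ⊗ₜ u) := by
  rw [genSpan_tmul_eq_range S m hirr hu]
  exact ⟨y, rfl⟩

end Tensor

end Summit.Ventures.HodgeRepro2.T5TensorSlot
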